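import Literature.AlgebraicTopology.SingularHomology.LocalHomologyUniverse
import Mathlib.Topology.OpenPartialHomeomorph.Constructions
import Mathlib.Topology.Algebra.Module.FiniteDimension
import Mathlib.Analysis.InnerProductSpace.PiL2
import HarnessLib

/-!
# Invariance of dimension at a point, via local homology (Hatcher Thm. 2.26, §3.3)

Layer `Literature/AlgebraicTopology/SingularHomology`.  Theorems only (no definition, no named fact).
Brouwer's invariance of dimension in its LOCAL form: a `T₁` space `S` cannot be homeomorphic near
one and the same point `p` to open subsets of finite-dimensional real normed spaces of different
dimensions — because the local homology `H_m(S | p; ℤ)` is, through a chart to `ℝ^m`, the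
non-zero group `H_m(ℝ^m | ·; ℤ) ≅ ℤ` (`not_isZero_localHomology`) and, through a chart to `ℝ^d`
with `d ≠ m`, the zero group `H_m(ℝ^d | ·; ℤ)` (`isZero_localHomology_of_ne`), both transported by
the tree's `localHomology.chartXEquiv` (excision).  Mathlib has no invariance of domain/dimension;
the tree's local homology of manifolds (`LocalHomologyUniverse`, Hatcher §3.3 p. 231) gives the
point version in a few lines.  (Cf. the remark «full rigidity `n = d` is invariance of dimension for
the topological manifold `X(ℂ)`» in `HodgeTheory/RationalHodgeClassesNonempty`, and the special case
`eq_of_mem_source_openPartialHomeomorph_rvec` in `Barriers/HodgeConjecture/IntegralCoefficientsCurvePurity`.)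

* `finrank_eq_of_mem_source_of_mem_source` — charts `S ⇀ V₁`, `S ⇀ V₂` (open partial
  homeomorphisms to finite-dimensional real normed spaces) whose sources both contain `p` force
  `dim V₁ = dim V₂`;
* `exists_openPartialHomeomorph_of_homeomorph` — a homeomorphism between an open neighbourhood
  `U ∋ p` and an open subset of `V` extends to such a chart (`OpenPartialHomeomorph.lift_openEmbedding`);
* `finrank_eq_of_homeomorph_nhds` — the neighbourhood form used by consumers (e.g. the discharge of
  `GroupActions.Milne2017_fixedComponent_dim_eq_finrank_tangentFixed`: the fixed locus of a
  finite-order automorphism near a fixed point is locally both a piece of a smooth subvariety and a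
  piece of a linear subspace).

## References

* [HatcherAT2002] A. Hatcher, *Algebraic Topology*, CUP 2002, Thm. 2.26 (invariance of dimension)
  and §3.3 p. 231 (local homology of manifolds).
-/

noncomputable section

open CategoryTheory Function Set

namespace Literature.AlgebraicTopology.SingularHomology

/-! ### Invariance of dimension at a point (local homology) -/

section Dimension

/-- **Invariance of dimension at a point.**  A `T₁` space admitting, at one and the same point,
charts (open partial homeomorphisms) to two finite-dimensional real normed spaces forces the two
dimensions to agree: the local homology `H_{m₁}(S | p; ℤ)` is `≅ H_{m₁}(ℝ^{m₁} | ·) ≠ 0` through the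
first chart and `≅ H_{m₁}(ℝ^{m₂} | ·) = 0` through the second if `m₁ ≠ m₂` (Hatcher 2002, Thm. 2.26
and §3.3 p. 231). [cite: HatcherAT2002, Thm. 2.26 and §3.3 p. 231] -/
theorem finrank_eq_of_mem_source_of_mem_source {S : Type} [TopologicalSpace S] [T1Space S]
    {V₁ V₂ : Type} [NormedAddCommGroup V₁] [NormedSpace ℝ V₁] [FiniteDimensional ℝ V₁]
    [NormedAddCommGroup V₂] [NormedSpace ℝ V₂] [FiniteDimensional ℝ V₂]
    (e₁ : OpenPartialHomeomorph S V₁) (e₂ : OpenPartialHomeomorph S V₂) {p : S}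
    (h₁ : p ∈ e₁.source) (h₂ : p ∈ e₂.source) :
    Module.finrank ℝ V₁ = Module.finrank ℝ V₂ := by
  set m₁ := Module.finrank ℝ V₁ with hm₁
  set m₂ := Module.finrank ℝ V₂ with hm₂
  let i₁ : V₁ ≃L[ℝ] EuclideanSpace ℝ (Fin m₁) := ContinuousLinearEquiv.ofFinrankEq (by simp [hm₁])
  let i₂ : V₂ ≃L[ℝ] EuclideanSpace ℝ (Fin m₂) := ContinuousLinearEquiv.ofFinrankEq (by simp [hm₂])
  let c₁ : OpenPartialHomeomorph S (EuclideanSpace ℝ (Fin m₁)) := e₁.transHomeomorph i₁.toHomeomorph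
  let c₂ : OpenPartialHomeomorph S (EuclideanSpace ℝ (Fin m₂)) := e₂.transHomeomorph i₂.toHomeomorph
  have hc₁ : p ∈ c₁.source := by
    rw [OpenPartialHomeomorph.transHomeomorph_source]; exact h₁
  have hc₂ : p ∈ c₂.source := by
    rw [OpenPartialHomeomorph.transHomeomorph_source]; exact h₂
  by_contra hne
  have hz₂ : Limits.IsZero (localHomology ℤ ℤ (EuclideanSpace ℝ (Fin m₂)) (c₂ p) m₁) :=
    isZero_localHomology_of_ne ℤ ℤ (c₂ p) hne
  have hzS : Limits.IsZero (localHomology ℤ ℤ S p m₁) :=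
    (isZero_iff_of_linearEquiv ℤ (localHomology.chartXEquiv ℤ ℤ c₂ hc₂ m₁)).2 hz₂
  have hz₁ : Limits.IsZero (localHomology ℤ ℤ (EuclideanSpace ℝ (Fin m₁)) (c₁ p) m₁) :=
    (isZero_iff_of_linearEquiv ℤ (localHomology.chartXEquiv ℤ ℤ c₁ hc₁ m₁)).1 hzS
  exact not_isZero_localHomology (R := ℤ) (c₁ p) hz₁

/-- A chart of `S` at `p` out of a homeomorphism between an open neighbourhood `U ∋ p` and an open
subset `O` of the model space (extension along the open embedding `U ↪ S`,
`OpenPartialHomeomorph.lift_openEmbedding`). [folklore] -/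
private theorem exists_openPartialHomeomorph_of_homeomorph {S : Type} [TopologicalSpace S]
    {V : Type} [NormedAddCommGroup V] [NormedSpace ℝ V]
    {U : Set S} (hU : IsOpen U) {p : S} (hp : p ∈ U) {O : Set V} (hO : IsOpen O)
    (e : U ≃ₜ O) : ∃ c : OpenPartialHomeomorph S V, p ∈ c.source := by
  haveI : Nonempty O := ⟨e ⟨p, hp⟩⟩
  let O' : TopologicalSpace.Opens V := ⟨O, hO⟩
  let c₀ : OpenPartialHomeomorph U V :=
    e.toOpenPartialHomeomorph.trans (O'.openPartialHomeomorphSubtypeCoe ‹_›)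
  refine ⟨c₀.lift_openEmbedding hU.isOpenEmbedding_subtypeVal, ?_⟩
  rw [OpenPartialHomeomorph.lift_openEmbedding_source]
  refine ⟨⟨p, hp⟩, ?_, rfl⟩
  simp [c₀]

/-- **Invariance of dimension at a point, neighbourhood form**: if `p ∈ S` (`S` a `T₁` space) has
open neighbourhoods homeomorphic to open subsets of finite-dimensional real normed spaces `V₁` and
`V₂`, then `dim V₁ = dim V₂`. [cite: HatcherAT2002, Thm. 2.26] -/
theorem finrank_eq_of_homeomorph_nhds {S : Type} [TopologicalSpace S] [T1Space S]
    {V₁ V₂ : Type} [NormedAddCommGroup V₁] [NormedSpace ℝ V₁] [FiniteDimensional ℝ V₁]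
    [NormedAddCommGroup V₂] [NormedSpace ℝ V₂] [FiniteDimensional ℝ V₂] {p : S}
    {U₁ : Set S} (hU₁ : IsOpen U₁) (hp₁ : p ∈ U₁) {O₁ : Set V₁} (hO₁ : IsOpen O₁) (e₁ : U₁ ≃ₜ O₁)
    {U₂ : Set S} (hU₂ : IsOpen U₂) (hp₂ : p ∈ U₂) {O₂ : Set V₂} (hO₂ : IsOpen O₂) (e₂ : U₂ ≃ₜ O₂) :
    Module.finrank ℝ V₁ = Module.finrank ℝ V₂ := by
  obtain ⟨c₁, hc₁⟩ := exists_openPartialHomeomorph_of_homeomorph hU₁ hp₁ hO₁ e₁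
  obtain ⟨c₂, hc₂⟩ := exists_openPartialHomeomorph_of_homeomorph hU₂ hp₂ hO₂ e₂
  exact finrank_eq_of_mem_source_of_mem_source c₁ c₂ hc₁ hc₂

end Dimension

end Literature.AlgebraicTopology.SingularHomology

end
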